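import Literature.Computability.MetaComplexity.EFScaffold
import HarnessLib

/-!
# Netlists for extended Frege proofs: gate templates, instances, extension definitions

The circuit layer of the `EF`-proof construction kit (`EFScaffold.lean`): Boolean circuits are
introduced into an extended Frege proof as *abbreviations*, one extension axiom
`g ↔ body(args)` per gate (Cook–Reckhow 1979, §4), and reasoned about gate by gate under a
context `K`. This file fixes the gate kinds, the template/instance discipline for allocating
gate variables, the semantics used for the covering (soundness) side of interpolation
statements, and the first generic law, the Leibniz (congruence) block.

## Content

* `Netlist.Kind` (constants, `¬`, `∧`, `∨`, `⊕₃`, `maj`, `mux`) with defining formulas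
  `Kind.body` (over `¬, ∧, ∨`; `xor3F`, `majF`, `muxF`), Boolean functions `Kind.fn`, and
  `Kind.eval_body` (the body evaluates to the function of the argument values).
* `Netlist.TGate`, `Netlist.Template` (gates referring to inputs `Sum.inl i` or earlier gates
  `Sum.inr j`), `Template.WF`; `Netlist.Inst` (input variables and a base index: gate `k` is
  the variable `base + k`), `Inst.body`, `Inst.defs` (the extension definitions), and
  `Inst.isExtList_defs`: instances of well-formed templates allocated above their inputs are
  well-allocated extension lists (`FregeSystem.IsExtList`).
* Semantics: `Netlist.wireVal` (wire values by well-founded recursion), `Inst.assign` (the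
  assignment extending `σ₀` by the wire values), `Inst.Sat`, and `Inst.sat_assign` (it
  satisfies every definition) — used to witness the satisfiability of constraint lists built
  from netlists.
* Proof side: `Netlist.ctx K L = K ∨ L`, `Netlist.eqv a b = a ↔ b`; the Leibniz rules `rLeib`
  (one per kind, `Netlist.rules`, sound by truth tables) and the **Leibniz block**
  `isBlock_leibLines`: two instances of one template with provably equal inputs have provably
  equal wires, one inference per gate; `Inst.DefsAvail` (availability of the contextualised
  definitions, from `Scaffold.Avail` by `defsAvail_of_subset[_constraints]`); composition
  `Netlist.embed` / `Inst.subInst` with `Inst.DefsAvail.subInst` (laws proved for a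
  sub-template apply inside a larger one); gate-indexed blocks `isBlock_map_range`.

## Sources

* S. A. Cook, R. A. Reckhow, *The relative efficiency of propositional proof systems*,
  J. Symbolic Logic 44 (1979), §4, Def. 4.1 (extension axioms abbreviating formulas), §2
  (sound schematic rules).
* H. Vollmer, *Introduction to Circuit Complexity* (Springer 1999), §1.1–1.2, Def. 1.6–1.7
  (circuits as straight-line programs over a basis, composition).

## Design notes

* Gate arguments beyond the arity are ignored by `Kind.body`/`Kind.fn`; missing ones read `⊥`.
  `Template.WF` demands the exact arity, references to inputs `< nIn` and to earlier gates.
* All laws are stated for an arbitrary context formula `K` and an arbitrary available set `Γ`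
  containing the needed definitions and input facts, and for any rule list `G` containing the
  layer's rules (`∀ r ∈ Netlist.rules, r ∈ G.rules`); the final system is the concatenation of
  the layers' rule lists.
-/

namespace Literature.Computability.MetaComplexity

open _root_.Computability Complexity Complexity.PropForm

namespace Netlist

/-! ### Gate kinds and their defining formulas -/

/-- The gate kinds of the netlists: constants, `¬`, binary `∧`, `∨`, ternary parity `⊕₃`,
majority and multiplexer `s ? a : b`. [cite: Vollmer1999, §1.1] -/
inductive Kind
  | cst (b : Bool)
  | not
  | and
  | or
  | xor3
  | maj
  | mux
  deriving DecidableEq, Repr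

/-- The number of arguments of a gate kind. [cite: Vollmer1999, §1.1] -/
def Kind.arity : Kind → ℕ
  | cst _ => 0
  | not => 1
  | and => 2
  | or => 2
  | xor3 => 3
  | maj => 3
  | mux => 3

/-- Ternary parity in the basis `¬, ∧, ∨`: `a ⊕ b ⊕ c = (a ↔ (b ↔ c))`. [folklore] -/
def xor3F (a b c : PropForm ℕ) : PropForm ℕ := biimp a (biimp b c)

/-- Majority of three: `ab ∨ c(a ∨ b)`. [folklore] -/
def majF (a b c : PropForm ℕ) : PropForm ℕ := disj (conj a b) (conj c (disj a b))

/-- Multiplexer `s ? a : b = (s ∧ a) ∨ (¬s ∧ b)`. [folklore] -/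
def muxF (s a b : PropForm ℕ) : PropForm ℕ := disj (conj s a) (conj (neg s) b)

/-- Argument `i` of an argument list (`⊥` if missing). [folklore] -/
def arg (l : List (PropForm ℕ)) (i : ℕ) : PropForm ℕ := l.getD i (const false)

/-- The defining formula of a gate of kind `k` on the argument formulas `l`.
[cite: CookReckhow1979, Def. 4.1] -/
def Kind.body : Kind → List (PropForm ℕ) → PropForm ℕ
  | cst b, _ => const b
  | not, l => neg (arg l 0)
  | and, l => conj (arg l 0) (arg l 1)
  | or, l => disj (arg l 0) (arg l 1)
  | xor3, l => xor3F (arg l 0) (arg l 1) (arg l 2)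
  | maj, l => majF (arg l 0) (arg l 1) (arg l 2)
  | mux, l => muxF (arg l 0) (arg l 1) (arg l 2)

/-- The Boolean function of a gate kind on (up to) three argument values.
[cite: Vollmer1999, §1.1] -/
def Kind.fn : Kind → Bool → Bool → Bool → Bool
  | cst b, _, _, _ => b
  | not, a, _, _ => !a
  | and, a, b, _ => a && b
  | or, a, b, _ => a || b
  | xor3, a, b, c => (a ^^ b) ^^ c
  | maj, a, b, c => (a && b) || (c && (a || b))
  | mux, s, a, b => (s && a) || (!s && b)

/-- Evaluating an argument: the value of the `i`-th argument formula, `false` if missing.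
[folklore] -/
theorem eval_arg (σ : ℕ → Bool) (l : List (PropForm ℕ)) (i : ℕ) :
    (arg l i).eval σ = (l.map (PropForm.eval σ)).getD i false := by
  simp only [arg, List.getD_eq_getElem?_getD, List.getElem?_map]
  cases l[i]? <;> rfl

/-- **Semantics of gate bodies**: the defining formula of a gate evaluates to the gate function
of the values of its first three arguments. [folklore] -/
theorem Kind.eval_body (σ : ℕ → Bool) (k : Kind) (l : List (PropForm ℕ)) :
    (k.body l).eval σ = k.fn ((arg l 0).eval σ) ((arg l 1).eval σ) ((arg l 2).eval σ) := by
  cases k <;> cases ha : (arg l 0).eval σ <;> cases hb : (arg l 1).eval σ <;>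
    cases hc : (arg l 2).eval σ <;> simp [body, fn, eval, xor3F, majF, muxF, ha, hb, hc]

/-- Variables of an argument are variables of the argument list. [folklore] -/
theorem mem_vars_arg {l : List (PropForm ℕ)} {i x : ℕ} (h : x ∈ (arg l i).vars) :
    ∃ a ∈ l, x ∈ a.vars := by
  simp only [arg, List.getD_eq_getElem?_getD] at h
  cases hl : l[i]? with
  | none => simp [hl, vars] at h
  | some a =>
    rw [hl] at h
    exact ⟨a, List.mem_of_getElem? hl, h⟩

/-- Variables of a gate body are variables of its arguments. [folklore] -/
theorem Kind.mem_vars_body {k : Kind} {l : List (PropForm ℕ)} {x : ℕ} (h : x ∈ (k.body l).vars) :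
    ∃ a ∈ l, x ∈ a.vars := by
  cases k with
  | cst b => simp [body, vars] at h
  | not => exact mem_vars_arg (by simpa [body, vars] using h)
  | and =>
    simp only [body, vars, Finset.mem_union] at h
    exact h.elim mem_vars_arg mem_vars_arg
  | or =>
    simp only [body, vars, Finset.mem_union] at h
    exact h.elim mem_vars_arg mem_vars_arg
  | xor3 =>
    rw [body, xor3F, FregeSystem.mem_vars_biimp, FregeSystem.mem_vars_biimp] at h
    exact h.elim mem_vars_arg fun h => h.elim mem_vars_arg mem_vars_arg
  | maj =>
    simp only [body, majF, vars, Finset.mem_union] at h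
    rcases h with (h | h) | h | h | h <;> exact mem_vars_arg h
  | mux =>
    simp only [body, muxF, vars, Finset.mem_union] at h
    rcases h with (h | h) | h | h <;> exact mem_vars_arg h

/-- Size of a gate body with variable (or constant) arguments: at most `25`. [folklore] -/
theorem Kind.size_body_le {k : Kind} {l : List (PropForm ℕ)} (hl : ∀ a ∈ l, a.size = 1) :
    (k.body l).size ≤ 25 := by
  have harg : ∀ i, (arg l i).size = 1 := by
    intro i
    simp only [arg, List.getD_eq_getElem?_getD]
    cases hl' : l[i]? with
    | none => rfl
    | some a => exact hl a (List.mem_of_getElem? hl')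
  cases k <;> simp only [body, xor3F, majF, muxF, size, FregeSystem.size_biimp, harg] <;> omega

/-! ### Templates and instances -/

/-- A template gate: a kind and argument references, `Sum.inl i` = input number `i` of the
template, `Sum.inr j` = (the output of) gate number `j`. [cite: Vollmer1999, Def. 1.6] -/
structure TGate where
  /-- the kind of the gate -/
  kind : Kind
  /-- the argument wires -/
  args : List (ℕ ⊕ ℕ)
  deriving DecidableEq, Repr

/-- A template (netlist): a list of template gates in topological order.
[cite: Vollmer1999, Def. 1.6] -/
abbrev Template := List TGate

/-- Well-formedness of a template with `nIn` inputs: gate `k` only refers to inputs `< nIn` and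
to gates `< k`. [cite: Vollmer1999, Def. 1.6] -/
def Template.WF (t : Template) (nIn : ℕ) : Prop :=
  ∀ (k : ℕ) (hk : k < t.length), (t[k]).args.length = (t[k]).kind.arity ∧ ∀ a ∈ (t[k]).args,
    (∀ i, a = Sum.inl i → i < nIn) ∧ (∀ j, a = Sum.inr j → j < k)

/-- An instance of a template: the variables carrying its inputs and the base index from which
its gates are allocated consecutively (gate `k` is the variable `base + k`).
[cite: CookReckhow1979, Def. 4.1] -/
structure Inst where
  /-- the input variables -/
  inputs : List ℕ
  /-- the first gate variable -/
  base : ℕ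
  deriving DecidableEq, Repr

/-- The variable of gate `k` of an instance. [folklore] -/
def Inst.wire (I : Inst) (k : ℕ) : ℕ := I.base + k

/-- The variable referred to by an argument reference (input `i`, defaulting to `0`, or gate
`j`). [folklore] -/
def Inst.ref (I : Inst) : ℕ ⊕ ℕ → ℕ
  | Sum.inl i => I.inputs.getD i 0
  | Sum.inr j => I.wire j

/-- The defining formula of gate `g` in the instance `I`. [cite: CookReckhow1979, Def. 4.1] -/
def Inst.body (I : Inst) (g : TGate) : PropForm ℕ :=
  g.kind.body (g.args.map fun a => var (I.ref a))

/-- The extension definitions `(base + k, body of gate k)` of an instance of a template.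
[cite: CookReckhow1979, Def. 4.1] -/
def Inst.defs (I : Inst) (t : Template) : List (ℕ × PropForm ℕ) :=
  t.mapIdx fun k g => (I.wire k, I.body g)

/-- The `k`-th definition. [folklore] -/
theorem Inst.getElem_defs (I : Inst) (t : Template) {k : ℕ} (hk : k < (I.defs t).length) :
    (I.defs t)[k] = (I.wire k, I.body (t[k]'(by simpa [Inst.defs] using hk))) := by
  simp [Inst.defs]

/-- Number of definitions. [folklore] -/
@[simp] theorem Inst.length_defs (I : Inst) (t : Template) : (I.defs t).length = t.length := by
  simp [Inst.defs]

/-- Membership in the definitions. [folklore] -/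
theorem Inst.mem_defs_iff (I : Inst) (t : Template) {e : ℕ × PropForm ℕ} :
    e ∈ I.defs t ↔ ∃ (k : ℕ) (hk : k < t.length), e = (I.wire k, I.body t[k]) := by
  constructor
  · intro h
    obtain ⟨k, hk, rfl⟩ := List.getElem_of_mem h
    exact ⟨k, by simpa using hk, by rw [Inst.getElem_defs]⟩
  · rintro ⟨k, hk, rfl⟩
    have hk' : k < (I.defs t).length := by simpa using hk
    have := List.getElem_mem hk'
    rwa [Inst.getElem_defs] at this

/-- The definition of gate `k` is among the definitions. [folklore] -/
theorem Inst.wire_body_mem_defs (I : Inst) (t : Template) {k : ℕ} (hk : k < t.length) :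
    (I.wire k, I.body t[k]) ∈ I.defs t :=
  (I.mem_defs_iff t).2 ⟨k, hk, rfl⟩

/-- **Instances of well-formed templates are well allocated**: if the inputs lie below `base`
and `b ≤ base`, the definitions of the instance are well allocated above `b`
(`FregeSystem.IsExtList`). [cite: CookReckhow1979, Def. 4.1] -/
theorem Inst.isExtList_defs (I : Inst) {t : Template} {nIn b : ℕ} (hwf : t.WF nIn)
    (hin : ∀ i < nIn, I.inputs.getD i 0 < I.base) (hb : b ≤ I.base) :
    FregeSystem.IsExtList b (I.defs t) := by
  refine ⟨fun e he => ?_, ?_, fun e he => ?_⟩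
  · obtain ⟨k, hk, rfl⟩ := (I.mem_defs_iff t).1 he
    simp only [Inst.wire]
    omega
  · rw [List.pairwise_iff_getElem]
    intro i j hi hj hij
    rw [Inst.getElem_defs, Inst.getElem_defs]
    simp only [Inst.wire]
    omega
  · obtain ⟨k, hk, rfl⟩ := (I.mem_defs_iff t).1 he
    -- every variable of the body is an input or an earlier gate
    refine bound_le_of_forall_lt fun x hx => ?_
    obtain ⟨a, ha, hxa⟩ := Kind.mem_vars_body hx
    obtain ⟨r, hr, rfl⟩ := List.mem_map.1 ha
    simp only [vars, Finset.mem_singleton] at hxa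
    subst hxa
    obtain ⟨h₁, h₂⟩ := (hwf k hk).2 r hr
    cases r with
    | inl i => exact (hin i (h₁ i rfl)).trans_le (Nat.le_add_right _ _)
    | inr j =>
      have := h₂ j rfl
      simp only [Inst.ref, Inst.wire]
      omega

/-! ### Semantics of instances -/

/-- The value of an argument reference, given input values and wire values. [folklore] -/
def refVal (inp w : ℕ → Bool) : ℕ ⊕ ℕ → Bool
  | Sum.inl i => inp i
  | Sum.inr j => w j

/-- The value of the `i`-th argument of a gate (`false` if missing). [folklore] -/
def argVal (inp w : ℕ → Bool) (args : List (ℕ ⊕ ℕ)) (i : ℕ) : Bool :=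
  match args[i]? with
  | none => false
  | some a => refVal inp w a

/-- **The wire values of a template** on input values `inp`: gate `k` applies its function to
the values of its arguments, earlier wires being read recursively (references to wires `≥ k`,
absent in well-formed templates, read `false`). [cite: Vollmer1999, Def. 1.7] -/
def wireVal (t : Template) (inp : ℕ → Bool) (k : ℕ) : Bool :=
  match t[k]? with
  | none => false
  | some g =>
    g.kind.fn (argVal inp (fun j => if j < k then wireVal t inp j else false) g.args 0)
      (argVal inp (fun j => if j < k then wireVal t inp j else false) g.args 1)
      (argVal inp (fun j => if j < k then wireVal t inp j else false) g.args 2)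
termination_by k
decreasing_by all_goals assumption

/-- The wire values of a gate of a well-formed template: its function applied to the values
of its arguments, wires read through `wireVal` itself. [cite: Vollmer1999, Def. 1.7] -/
theorem wireVal_eq {t : Template} {nIn : ℕ} (hwf : t.WF nIn) (inp : ℕ → Bool) {k : ℕ}
    (hk : k < t.length) :
    wireVal t inp k = (t[k]).kind.fn (argVal inp (wireVal t inp) (t[k]).args 0)
      (argVal inp (wireVal t inp) (t[k]).args 1) (argVal inp (wireVal t inp) (t[k]).args 2) := by
  rw [wireVal]
  simp only [List.getElem?_eq_getElem hk]
  have harg : ∀ i, argVal inp (fun j => if j < k then wireVal t inp j else false) (t[k]).args i =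
      argVal inp (wireVal t inp) (t[k]).args i := by
    intro i
    unfold argVal
    cases ha : (t[k]).args[i]? with
    | none => rfl
    | some a =>
      cases a with
      | inl i' => rfl
      | inr j =>
        have hj := ((hwf k hk).2 _ (List.mem_of_getElem? ha)).2 j rfl
        simp [refVal, hj]
  rw [harg, harg, harg]

/-- The assignment of an instance extending `σ₀`: the gate variables `base, …, base + |t| - 1`
receive the wire values on the input values read from `σ₀`, all other variables keep their
`σ₀`-value. [folklore] -/
def Inst.assign (I : Inst) (t : Template) (σ₀ : ℕ → Bool) (v : ℕ) : Bool :=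
  if I.base ≤ v ∧ v < I.base + t.length then wireVal t (fun i => σ₀ (I.inputs.getD i 0)) (v - I.base)
  else σ₀ v

/-- `I.Sat t σ`: the assignment `σ` satisfies all gate definitions of the instance.
[cite: CookReckhow1979, Def. 4.1] -/
def Inst.Sat (I : Inst) (t : Template) (σ : ℕ → Bool) : Prop :=
  ∀ (k : ℕ) (hk : k < t.length), σ (I.wire k) = (I.body t[k]).eval σ

/-- Satisfaction means that every extension axiom / constraint `wire k ↔ body k` is true.
[cite: CookReckhow1979, Def. 4.1] -/
theorem Inst.Sat.eval_biimp {I : Inst} {t : Template} {σ : ℕ → Bool} (h : I.Sat t σ) {k : ℕ}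
    (hk : k < t.length) : (biimp (var (I.wire k)) (I.body t[k])).eval σ = true := by
  rw [PropForm.eval_biimp, eval, h k hk]
  simp

/-- Outside its gate variables the assignment of an instance is `σ₀`. [folklore] -/
theorem Inst.assign_of_not_mem (I : Inst) (t : Template) (σ₀ : ℕ → Bool) {v : ℕ}
    (hv : ¬ (I.base ≤ v ∧ v < I.base + t.length)) : I.assign t σ₀ v = σ₀ v := by
  simp [Inst.assign, hv]

/-- On its gate variables the assignment of an instance gives the wire values. [folklore] -/
theorem Inst.assign_wire (I : Inst) (t : Template) (σ₀ : ℕ → Bool) {k : ℕ} (hk : k < t.length) :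
    I.assign t σ₀ (I.wire k) = wireVal t (fun i => σ₀ (I.inputs.getD i 0)) k := by
  simp [Inst.assign, Inst.wire, hk]

/-- **The assignment of an instance of a well-formed template satisfies it**, provided the
input variables lie below `base`. [folklore] -/
theorem Inst.sat_assign (I : Inst) {t : Template} {nIn : ℕ} (hwf : t.WF nIn)
    (hin : ∀ i < nIn, I.inputs.getD i 0 < I.base) (σ₀ : ℕ → Bool) : I.Sat t (I.assign t σ₀) := by
  intro k hk
  set inp : ℕ → Bool := fun i => σ₀ (I.inputs.getD i 0) with hinp
  rw [I.assign_wire t σ₀ hk, wireVal_eq hwf inp hk, Inst.body, Kind.eval_body]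
  have harg : ∀ i, (arg ((t[k]).args.map fun a => var (I.ref a)) i).eval (I.assign t σ₀) =
      argVal inp (wireVal t inp) (t[k]).args i := by
    intro i
    simp only [arg, argVal, List.getD_eq_getElem?_getD, List.getElem?_map]
    cases ha : (t[k]).args[i]? with
    | none => rfl
    | some a =>
      obtain ⟨h₁, h₂⟩ := (hwf k hk).2 a (List.mem_of_getElem? ha)
      cases a with
      | inl i' =>
        have hlt := hin i' (h₁ i' rfl)
        simp only [Option.map_some, Option.getD_some, eval, Inst.ref, refVal]
        rw [I.assign_of_not_mem t σ₀ (by omega)]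
      | inr j =>
        have hj := h₂ j rfl
        simp only [Option.map_some, Option.getD_some, eval, Inst.ref, refVal]
        exact I.assign_wire t σ₀ (by omega)
  rw [harg, harg, harg]

/-! ### Lines under the context, and the Leibniz (congruence) block -/

/-- A line under the context `K`: `K ∨ L` (`K` is the context variable of the scaffold,
possibly extended by case hypotheses `K ∨ ¬A₁ ∨ ⋯`). [folklore] -/
def ctx (K L : PropForm ℕ) : PropForm ℕ := disj K L

/-- Equality of two bits: `a ↔ b`. [folklore] -/
def eqv (a b : ℕ) : PropForm ℕ := biimp (var a) (var b)

/-- The **Leibniz rule** for gates of kind `k`: two gates of kind `k` with pairwise equal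
arguments have equal outputs (under a context `K`):
`K ∨ (g ↔ body(a…)), K ∨ (g' ↔ body(a'…)), K ∨ (aᵢ ↔ aᵢ') ⊢ K ∨ (g ↔ g')`.
[cite: CookReckhow1979, §2 (sound rule)] -/
def rLeib (k : Kind) (ar : ℕ) : FregeRule :=
  ⟨ctx (var 0) (biimp (var 1) (k.body [var 2, var 3, var 4])) ::
    ctx (var 0) (biimp (var 5) (k.body [var 6, var 7, var 8])) ::
    (List.range ar).map (fun i => ctx (var 0) (eqv (2 + i) (6 + i))),
   ctx (var 0) (eqv 1 5)⟩

/-- The rules of the netlist layer: the Leibniz rules of the seven gate kinds.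
[cite: CookReckhow1979, §2] -/
def rules : List FregeRule :=
  [rLeib (Kind.cst false) 0, rLeib (Kind.cst true) 0, rLeib Kind.not 1, rLeib Kind.and 2,
    rLeib Kind.or 2, rLeib Kind.xor3 3, rLeib Kind.maj 3, rLeib Kind.mux 3]

/-- Every netlist rule is sound (truth tables). [cite: CookReckhow1979, §2 (sound rule)] -/
theorem isSound_of_mem_rules : ∀ r ∈ rules, r.IsSound := by
  intro r hr
  simp only [rules, List.mem_cons, List.not_mem_nil, or_false] at hr
  rcases hr with rfl | rfl | rfl | rfl | rfl | rfl | rfl | rfl <;>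
    exact FregeRule.isSound_of_check (by decide +kernel)

/-- The Leibniz rule of the kind of a well-formed gate is a netlist rule. [folklore] -/
theorem rLeib_mem_rules (k : Kind) : rLeib k k.arity ∈ rules := by
  rcases k with (_ | _) | _ | _ | _ | _ | _ | _ <;> simp [rules, Kind.arity]

/-- The lines of the Leibniz block: `K ∨ (wire k ↔ wire' k)` for the first `n` gates of two
instances. [folklore] -/
def leibLines (I I' : Inst) (K : PropForm ℕ) (n : ℕ) : List (PropForm ℕ) :=
  (List.range n).map fun k => ctx K (eqv (I.wire k) (I'.wire k))

/-- Length of the Leibniz block. [folklore] -/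
@[simp] theorem length_leibLines (I I' : Inst) (K : PropForm ℕ) (n : ℕ) :
    (leibLines I I' K n).length = n := by
  simp [leibLines]

/-- Every line of the Leibniz block has size `|K| + 10`. [folklore] -/
theorem size_of_mem_leibLines {I I' : Inst} {K : PropForm ℕ} {n : ℕ} {θ : PropForm ℕ}
    (h : θ ∈ leibLines I I' K n) : θ.size = K.size + 10 := by
  obtain ⟨k, -, rfl⟩ := List.mem_map.1 h
  simp [ctx, eqv, size, FregeSystem.size_biimp]

/-- The equality line of gate `k < n` is in the Leibniz block. [folklore] -/
theorem mem_leibLines {I I' : Inst} {K : PropForm ℕ} {n k : ℕ} (hk : k < n) :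
    ctx K (eqv (I.wire k) (I'.wire k)) ∈ leibLines I I' K n :=
  List.mem_map.2 ⟨k, List.mem_range.2 hk, rfl⟩

variable {G : FregeSystem}

/-- One Leibniz inference: from the two contextualised definitions of gate number `n` (the same
template gate `g` in two instances) and the equalities of its argument variables, infer the
equality of the two gate variables. [cite: CookReckhow1979, §2] -/
theorem isInferredFrom_leib (hG : ∀ r ∈ rules, r ∈ G.rules) {S : Set (PropForm ℕ)} (I I' : Inst)
    (K : PropForm ℕ) (n : ℕ) (kd : Kind) (args : List (ℕ ⊕ ℕ)) (hlen : args.length = kd.arity)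
    (hd : ctx K (biimp (var (I.wire n)) (I.body ⟨kd, args⟩)) ∈ S)
    (hd' : ctx K (biimp (var (I'.wire n)) (I'.body ⟨kd, args⟩)) ∈ S)
    (hargs : ∀ a ∈ args, ctx K (eqv (I.ref a) (I'.ref a)) ∈ S) :
    G.IsInferredFrom S (ctx K (eqv (I.wire n) (I'.wire n))) := by
  have hr := hG _ (rLeib_mem_rules kd)
  rcases kd with b | _ | _ | _ | _ | _ | _ <;>
    rcases args with _ | ⟨a₁, _ | ⟨a₂, _ | ⟨a₃, _ | ⟨a₄, l⟩⟩⟩⟩ <;>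
    simp only [Kind.arity, List.length_cons, List.length_nil] at hlen <;> try omega
  · exact FregeSystem.IsInferredFrom.of_rule hr
      (FregeSystem.sub [K, var (I.wire n), const true, const true, const true, var (I'.wire n)])
      rfl (FregeSystem.prems_cons hd (FregeSystem.prems_cons hd' FregeSystem.prems_nil))
  · exact FregeSystem.IsInferredFrom.of_rule hr
      (FregeSystem.sub [K, var (I.wire n), var (I.ref a₁), const true, const true,
        var (I'.wire n), var (I'.ref a₁)])
      rfl (FregeSystem.prems_cons hd (FregeSystem.prems_cons hd'
        (FregeSystem.prems_cons (hargs a₁ (by simp)) FregeSystem.prems_nil)))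
  · exact FregeSystem.IsInferredFrom.of_rule hr
      (FregeSystem.sub [K, var (I.wire n), var (I.ref a₁), var (I.ref a₂), const true,
        var (I'.wire n), var (I'.ref a₁), var (I'.ref a₂)])
      rfl (FregeSystem.prems_cons hd (FregeSystem.prems_cons hd'
        (FregeSystem.prems_cons (hargs a₁ (by simp)) (FregeSystem.prems_cons (hargs a₂ (by simp)) FregeSystem.prems_nil))))
  · exact FregeSystem.IsInferredFrom.of_rule hr
      (FregeSystem.sub [K, var (I.wire n), var (I.ref a₁), var (I.ref a₂), const true,
        var (I'.wire n), var (I'.ref a₁), var (I'.ref a₂)])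
      rfl (FregeSystem.prems_cons hd (FregeSystem.prems_cons hd'
        (FregeSystem.prems_cons (hargs a₁ (by simp)) (FregeSystem.prems_cons (hargs a₂ (by simp)) FregeSystem.prems_nil))))
  all_goals
    exact FregeSystem.IsInferredFrom.of_rule hr
      (FregeSystem.sub [K, var (I.wire n), var (I.ref a₁), var (I.ref a₂), var (I.ref a₃),
        var (I'.wire n), var (I'.ref a₁), var (I'.ref a₂), var (I'.ref a₃)])
      rfl (FregeSystem.prems_cons hd (FregeSystem.prems_cons hd'
        (FregeSystem.prems_cons (hargs a₁ (by simp)) (FregeSystem.prems_cons (hargs a₂ (by simp))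
          (FregeSystem.prems_cons (hargs a₃ (by simp)) FregeSystem.prems_nil)))))

/-- **The Leibniz (congruence) block.** For two instances `I, I'` of a well-formed template
whose contextualised definitions are available, together with the equalities
`K ∨ (inᵢ ↔ inᵢ')` of their input variables, the lines `K ∨ (wire k ↔ wire' k)`, `k < n`, form a
block (one Leibniz inference per gate, in order). [cite: CookReckhow1979, §2] -/
theorem isBlock_leibLines (hG : ∀ r ∈ rules, r ∈ G.rules) {t : Template} {nIn : ℕ} (hwf : t.WF nIn)
    (I I' : Inst) (K : PropForm ℕ) {Γ : Set (PropForm ℕ)}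
    (hd : ∀ (k : ℕ) (hk : k < t.length), ctx K (biimp (var (I.wire k)) (I.body t[k])) ∈ Γ)
    (hd' : ∀ (k : ℕ) (hk : k < t.length), ctx K (biimp (var (I'.wire k)) (I'.body t[k])) ∈ Γ)
    (hin : ∀ i < nIn, ctx K (eqv (I.inputs.getD i 0) (I'.inputs.getD i 0)) ∈ Γ) :
    ∀ n ≤ t.length, G.IsBlock Γ (leibLines I I' K n)
  | 0, _ => FregeSystem.IsBlock.nil G Γ
  | n + 1, hn => by
    have hk : n < t.length := hn
    rw [leibLines, List.range_succ, List.map_append, List.map_singleton]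
    refine (isBlock_leibLines hG hwf I I' K hd hd' hin n hk.le).snoc (Or.inr ?_)
    refine isInferredFrom_leib hG I I' K n (t[n]).kind (t[n]).args (hwf n hk).1 (Or.inl (hd n hk))
      (Or.inl (hd' n hk)) fun a ha => ?_
    obtain ⟨h₁, h₂⟩ := (hwf n hk).2 a ha
    cases a with
    | inl i => exact Or.inl (hin i (h₁ i rfl))
    | inr j => exact Or.inr (mem_leibLines (h₂ j rfl))

/-! ### Availability of the definitions of an instance -/

/-- `I.DefsAvail t K Γ`: all contextualised definitions `K ∨ (wire k ↔ body k)` of the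
instance are in the available set `Γ`. [folklore] -/
def Inst.DefsAvail (I : Inst) (t : Template) (K : PropForm ℕ) (Γ : Set (PropForm ℕ)) : Prop :=
  ∀ (k : ℕ) (hk : k < t.length), ctx K (biimp (var (I.wire k)) (I.body t[k])) ∈ Γ

/-- Availability is monotone in the set. [folklore] -/
theorem Inst.DefsAvail.mono {I : Inst} {t : Template} {K : PropForm ℕ} {Γ Γ' : Set (PropForm ℕ)}
    (h : I.DefsAvail t K Γ) (hΓ : Γ ⊆ Γ') : I.DefsAvail t K Γ' := fun k hk => hΓ (h k hk)

/-- If the definitions of the instance are among the abbreviations `E` of the scaffold, they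
are available (`Scaffold.Avail`) under the context variable `κ`. [folklore] -/
theorem Inst.defsAvail_of_subset {I : Inst} {t : Template} {κ : ℕ} {T₀ T₁ : List (PropForm ℕ)}
    {E : List (ℕ × PropForm ℕ)} (h : ∀ e ∈ I.defs t, e ∈ E) :
    I.DefsAvail t (var κ) (Scaffold.Avail T₀ T₁ κ E) := fun k hk =>
  Or.inr ⟨(I.wire k, I.body t[k]), h _ (I.wire_body_mem_defs t hk), rfl⟩

/-- If the definitions of the instance are among the constraints `T₀ ++ T₁` of the scaffold (as
the formulas `wire k ↔ body k`), they are available (`Scaffold.Avail`) under the context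
variable `κ`. [folklore] -/
theorem Inst.defsAvail_of_subset_constraints {I : Inst} {t : Template} {κ : ℕ}
    {T₀ T₁ : List (PropForm ℕ)} {E : List (ℕ × PropForm ℕ)}
    (h : ∀ e ∈ I.defs t, biimp (var e.1) e.2 ∈ T₀ ++ T₁) :
    I.DefsAvail t (var κ) (Scaffold.Avail T₀ T₁ κ E) := fun k hk =>
  Or.inl ⟨biimp (var (I.wire k)) (I.body t[k]), h _ (I.wire_body_mem_defs t hk), rfl⟩

/-! ### Embedding a template into a larger one -/

/-- Re-wiring an argument reference of a sub-template placed at offset `off` inside a larger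
template, its inputs being connected by `w`. [cite: Vollmer1999, §1.2] -/
def remap (w : ℕ → ℕ ⊕ ℕ) (off : ℕ) : ℕ ⊕ ℕ → ℕ ⊕ ℕ
  | Sum.inl i => w i
  | Sum.inr j => Sum.inr (off + j)

/-- The sub-template `sub` placed at offset `off` with its inputs connected by `w`
(composition of circuits). [cite: Vollmer1999, §1.2] -/
def embed (sub : Template) (w : ℕ → ℕ ⊕ ℕ) (off : ℕ) : Template :=
  sub.map fun g => ⟨g.kind, g.args.map (remap w off)⟩

/-- Length of an embedded template. [folklore] -/
@[simp] theorem length_embed (sub : Template) (w : ℕ → ℕ ⊕ ℕ) (off : ℕ) :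
    (embed sub w off).length = sub.length := by
  simp [embed]

/-- Gates of an embedded template. [folklore] -/
theorem getElem_embed (sub : Template) (w : ℕ → ℕ ⊕ ℕ) (off : ℕ) {k : ℕ}
    (hk : k < (embed sub w off).length) :
    (embed sub w off)[k] = ⟨(sub[k]'(by simpa using hk)).kind, (sub[k]'(by simpa using hk)).args.map (remap w off)⟩ := by
  simp [embed]

/-- **The sub-instance**: the instance of `sub` (with `nIn` inputs) induced by an instance `I` of
a template containing `embed sub w off` at position `off`. [folklore] -/
def Inst.subInst (I : Inst) (w : ℕ → ℕ ⊕ ℕ) (off nIn : ℕ) : Inst :=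
  ⟨(List.range nIn).map fun i => I.ref (w i), I.base + off⟩

/-- Wires of the sub-instance are the wires of the instance, shifted. [folklore] -/
theorem Inst.wire_subInst (I : Inst) (w : ℕ → ℕ ⊕ ℕ) (off nIn k : ℕ) :
    (I.subInst w off nIn).wire k = I.wire (off + k) := by
  simp [Inst.subInst, Inst.wire, Nat.add_assoc]

/-- References of the sub-instance are the re-wired references of the instance. [folklore] -/
theorem Inst.ref_subInst (I : Inst) (w : ℕ → ℕ ⊕ ℕ) (off nIn : ℕ) {a : ℕ ⊕ ℕ}
    (ha : ∀ i, a = Sum.inl i → i < nIn) : (I.subInst w off nIn).ref a = I.ref (remap w off a) := by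
  cases a with
  | inl i =>
    have hi := ha i rfl
    simp [Inst.subInst, Inst.ref, remap, List.getD_eq_getElem?_getD, hi]
  | inr j => simp [Inst.ref, remap, Inst.wire_subInst]

/-- Bodies of the sub-instance are the bodies of the embedded gates. [folklore] -/
theorem Inst.body_subInst (I : Inst) (w : ℕ → ℕ ⊕ ℕ) (off nIn : ℕ) {g : TGate}
    (hg : ∀ a ∈ g.args, ∀ i, a = Sum.inl i → i < nIn) :
    (I.subInst w off nIn).body g = I.body ⟨g.kind, g.args.map (remap w off)⟩ := by
  simp only [Inst.body, List.map_map]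
  congr 1
  exact List.map_congr_left fun a ha => by simp [I.ref_subInst w off nIn (hg a ha)]

/-- **Definitions of a sub-instance are available when those of the instance are**: if the
template `t` contains `embed sub w off` at position `off`, the contextualised definitions of
`I.subInst w off nIn` w.r.t. `sub` are among those of `I` w.r.t. `t`. [folklore] -/
theorem Inst.DefsAvail.subInst {I : Inst} {t sub : Template} {w : ℕ → ℕ ⊕ ℕ} {off nIn : ℕ}
    {K : PropForm ℕ} {Γ : Set (PropForm ℕ)} (h : I.DefsAvail t K Γ) (hwf : sub.WF nIn)
    (ht : ∀ (k : ℕ) (hk : k < sub.length), ∃ hk' : off + k < t.length,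
      t[off + k] = ⟨(sub[k]).kind, (sub[k]).args.map (remap w off)⟩) :
    (I.subInst w off nIn).DefsAvail sub K Γ := by
  intro k hk
  obtain ⟨hk', heq⟩ := ht k hk
  have := h (off + k) hk'
  rw [heq] at this
  rwa [Inst.wire_subInst, I.body_subInst w off nIn fun a ha => ((hwf k hk).2 a ha).1]

/-- The gates of `pre ++ embed sub w pre.length ++ post` at the embedded positions.
[folklore] -/
theorem getElem_append_embed (pre sub post : Template) (w : ℕ → ℕ ⊕ ℕ) {k : ℕ}
    (hk : k < sub.length) :
    ∃ hk' : pre.length + k < (pre ++ embed sub w pre.length ++ post).length,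
      (pre ++ embed sub w pre.length ++ post)[pre.length + k] =
        ⟨(sub[k]).kind, (sub[k]).args.map (remap w pre.length)⟩ := by
  refine ⟨by simp; omega, ?_⟩
  rw [List.getElem_append_left (by simp; omega), List.getElem_append_right (by omega)]
  simp [embed]

/-- Well-formedness of an embedded template inside `pre ++ embed sub w pre.length ++ post`:
the embedded gates are well formed if `sub` is and the wiring `w` sends the inputs of `sub` to
inputs `< nIn` or to gates of `pre`. [cite: Vollmer1999, §1.2] -/
theorem wf_embed_gate {sub : Template} {nInSub nIn : ℕ} (hwf : sub.WF nInSub) {w : ℕ → ℕ ⊕ ℕ}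
    {off : ℕ} (hw : ∀ i < nInSub, (∀ i', w i = Sum.inl i' → i' < nIn) ∧ (∀ j, w i = Sum.inr j → j < off))
    {k : ℕ} (hk : k < sub.length) :
    ((sub[k]).args.map (remap w off)).length = (sub[k]).kind.arity ∧
      ∀ a ∈ (sub[k]).args.map (remap w off),
        (∀ i, a = Sum.inl i → i < nIn) ∧ (∀ j, a = Sum.inr j → j < off + k) := by
  obtain ⟨hlen, hargs⟩ := hwf k hk
  refine ⟨by simpa using hlen, fun a ha => ?_⟩
  obtain ⟨a₀, ha₀, rfl⟩ := List.mem_map.1 ha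
  obtain ⟨h₁, h₂⟩ := hargs a₀ ha₀
  cases a₀ with
  | inl i =>
    obtain ⟨hw₁, hw₂⟩ := hw i (h₁ i rfl)
    refine ⟨fun i' hi' => hw₁ i' hi', fun j hj => ?_⟩
    have := hw₂ j hj
    omega
  | inr j =>
    have hj := h₂ j rfl
    refine ⟨fun i' hi' => by simp [remap] at hi', fun j' hj' => ?_⟩
    simp only [remap, Sum.inr.injEq] at hj'
    omega

/-! ### Gate-indexed blocks -/

/-- **A gate-indexed block**: lines `line 0, …, line (n-1)` form a block over `Γ` as soon as
each `line k` is available or inferred from `Γ` and the earlier lines `line j`, `j < k` (the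
shape of every induction along the gates of a template). [folklore] -/
theorem isBlock_map_range {Γ : Set (PropForm ℕ)} {line : ℕ → PropForm ℕ} :
    ∀ n : ℕ, (∀ k < n, line k ∈ Γ ∨
      G.IsInferredFrom (Γ ∪ {χ | ∃ j < k, χ = line j}) (line k)) →
      G.IsBlock Γ ((List.range n).map line)
  | 0, _ => by simpa using FregeSystem.IsBlock.nil G Γ
  | n + 1, h => by
    rw [List.range_succ, List.map_append, List.map_singleton]
    refine (isBlock_map_range n fun k hk => h k (Nat.lt_succ_of_lt hk)).snoc ?_
    rcases h n (Nat.lt_succ_self n) with hm | hinf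
    · exact Or.inl (Or.inl hm)
    · refine Or.inr (hinf.mono ?_)
      rintro χ (hχ | ⟨j, hj, rfl⟩)
      · exact Or.inl hχ
      · exact Or.inr (List.mem_map.2 ⟨j, List.mem_range.2 hj, rfl⟩)

/-- Lines of a gate-indexed block. [folklore] -/
theorem mem_map_range {line : ℕ → PropForm ℕ} {n k : ℕ} (hk : k < n) :
    line k ∈ (List.range n).map line :=
  List.mem_map.2 ⟨k, List.mem_range.2 hk, rfl⟩

/-- Size of a gate-indexed block with lines of bounded size. [folklore] -/
theorem proofSize_map_range_le {line : ℕ → PropForm ℕ} {n s : ℕ} (h : ∀ k < n, (line k).size ≤ s) :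
    proofSize ((List.range n).map line) ≤ n * s := by
  induction n with
  | zero => simp [proofSize]
  | succ n ih =>
    rw [List.range_succ, List.map_append, List.map_singleton, proofSize_append,
      proofSize_singleton, Nat.succ_mul]
    exact Nat.add_le_add (ih fun k hk => h k (Nat.lt_succ_of_lt hk)) (h n (Nat.lt_succ_self n))

end Netlist

end Literature.Computability.MetaComplexity
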